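import Summits.BirchSwinnertonDyer.BirchSwinnertonDyer.Theorems.KolyvaginRoadThreeSchneiderTamAtThreeHeightLogNumeratorDeepRefinedLaws
import Literature.NumberTheory.EllipticCurves.SteinWuthrich2013.MultiplicativeHeightExistenceProofs
import HarnessLib

/-!
# Crux `SchneiderTamAtThree` (item 19154) — THE HEIGHT IS THE LOGARITHM OF THE NUMERATOR, DEEP POINTS,
# part 6c: THE canonical `3`-adic height of a deep admissible point in CLOSED RATIONAL FORM, by Kodaira type

HONEST FRAMING (cell `bsd-stepL`, seat `bsd-stepL-tam3-p2` g2, WIDTH-LEVER second lane «closed-form Schneider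
local factor at 3 … finite case table proved once»; `--supports stmt-BirchSwinnertonDyer-19154 --as helper`):
THEOREMS ONLY, unconditional, route-independent (no Theses import); 0 definitions, 0 named facts, 0 sorry;
nothing here proves the crux `SchneiderTamAtThree`, Schneider's conjecture or BSD. This file packages the
deep-point law (parts 3b–6b) for THE datum the crux quantifies over: a `p`-adic height datum `Dh` with
`IsMultCanonical Dh q` for the Tate parameter `q` of `W` at `3` (`‖q‖₃ < 1`, `tateJ q = j(W)`).

* `norm_pairing_self_sub_closedForm_le_of_isMultCanonical` — for `W/ℚ` globally minimal with multiplicative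
  reduction at `3`, THE canonical datum `Dh` (`IsMultCanonical Dh q`, `tateJ q = j`), and an ADMISSIBLE rational
  point `P = (x, y)` of level `k ≥ 2` (`3⁴ ∣ den x`):
  **`‖⟨P, P⟩_Dh − (log₃ a + [(b₂b₄ − 18b₆)/c₄ + 60(c₆/c₄)/j]·D/a)‖₃ ≤ ‖x‖₃⁻¹·max(‖x‖₃⁻¹, ‖1/j‖₃²)`**
  (`a = num x`, `D = den x`; `b₂, b₄, b₆, c₄, c₆, j` of the minimal model; `‖1/j‖₃ = 3^{−v₃Δ}`): Schneider's local
  factor at `3` on deep points is a RATIONAL closed form of the minimal model to `3^{−(2k + min(2k, 2v₃Δ))}` — the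
  Kodaira type `I_{v₃Δ}` fixes the reliable digits. What remains OPEN for the crux is whether this closed form
  (equivalently `⟨P,P⟩`) can vanish on every admissible point of a curve of the locus: `v₃⟨P,P⟩` is unbounded
  over the locus, so no finite precision decides the class.

References: [SteinWuthrich2013] §4.1–4.2, §6.1; [Schneider1982PadicHeightI] §1; [SilvermanATAEC1994] V.3, V.5;
tree: deep part 6b, `Literature.…SteinWuthrich2013.MultiplicativeLeadingTerm` (`IsMultCanonical`).
-/

noncomputable section

open scoped Classical Nat
open Filter Topology IsUltrametricDist PowerSeries
open WeierstrassCurve Literature.NumberTheory.EllipticCurves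
open Literature.NumberTheory.EllipticCurves.SteinWuthrich2013
open Literature.NumberTheory.EllipticCurves.TateCurve
open Literature.NumberTheory.EllipticCurves.Rank1Residual
open Summit.BirchSwinnertonDyer.Uniform.UI.O2

namespace Summit.BirchSwinnertonDyer.Rank1Residual.X11b.RegMult.HeightLogNumerator

section Canonical

variable {W : WeierstrassCurve ℚ}

/-- **THE canonical `3`-adic height of a deep admissible point in closed rational form.** For `W/ℚ` globally
minimal with multiplicative reduction at `3`, `q ∈ ℚ₃` with `‖q‖₃ < 1` and `tateJ q = j(W)`, a height datum
`Dh` with `IsMultCanonical Dh q` (SW 2013 §4.2: `⟨P,P⟩ = ĥ₃(P)` by formula (4.1) on admissible points), and an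
admissible rational point `P = (x, y)` with `3⁴ ∣ den x`:
`‖⟨P,P⟩ − (log₃ num x + [(b₂b₄ − 18b₆)/c₄ + 60(c₆/c₄)·j⁻¹]·den x/num x)‖₃ ≤ ‖x‖₃⁻¹·max(‖x‖₃⁻¹, ‖j⁻¹‖₃²)`.
(`‖q‖₃ = ‖j‖₃⁻¹` by `norm_tateJ_eq`; part 6b's `…_deep_j`.) [cite: SteinWuthrich2013, §4.1 eq. (4.1), §4.2]
[cite: Schneider1982PadicHeightI, §1] [cite: SilvermanATAEC1994, Thm. V.3.1 (b)] -/
theorem norm_pairing_self_sub_closedForm_le_of_isMultCanonical [W.IsElliptic] [W.IsGloballyMinimal]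
    (hW : Mult W 3) {q : ℚ_[3]} (hq : ‖q‖ < 1) (hj : tateJ q = (W.j : ℚ_[3])) {Dh : PAdicHeightData W 3}
    (hDh : IsMultCanonical Dh q) {x y : ℚ} {h : W.toAffine.Nonsingular x y}
    (hadm : W.IsAdmissible 3 (.some x y h)) (h4 : 4 ≤ padicValNat 3 x.den) :
    ‖Dh.pairing (.some x y h) (.some x y h) - (padicLog 3 ((x.num : ℚ) : ℚ_[3]) +
        (((W.baseChange ℚ_[3]).b₂ * (W.baseChange ℚ_[3]).b₄ - 18 * (W.baseChange ℚ_[3]).b₆) /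
            (W.baseChange ℚ_[3]).c₄ +
          60 * ((W.baseChange ℚ_[3]).c₆ / (W.baseChange ℚ_[3]).c₄) * ((W.j : ℚ_[3]))⁻¹) *
          (((x.den : ℚ) : ℚ_[3]) / ((x.num : ℚ) : ℚ_[3])))‖
      ≤ ‖(x : ℚ_[3])‖⁻¹ * max ‖(x : ℚ_[3])‖⁻¹ (‖((W.j : ℚ_[3]))⁻¹‖ ^ 2) := by
  have hx : 1 < ‖(x : ℚ_[3])‖ := hadm.2.1
  -- level `≥ 2`: `‖z‖² = ‖x‖⁻¹ ≤ 3⁻⁴`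
  have hden : ‖(x : ℚ_[3])‖⁻¹ = (3 : ℝ) ^ (-(padicValNat 3 x.den : ℤ)) := by
    rw [← norm_den_eq_inv_norm hx, Rat.cast_natCast,
      Padic.norm_eq_zpow_neg_valuation (by exact_mod_cast x.den_nz), Padic.valuation_natCast]
    norm_cast
  have hz9 : ‖-(x : ℚ_[3]) / y‖ ≤ 1 / 9 := by
    obtain ⟨-, hz2⟩ := norm_neg_div_of_one_lt_norm (p := 3) h hx
    have hsq : ‖-(x : ℚ_[3]) / y‖ ^ 2 ≤ (1 / 9) ^ 2 := by
      rw [hz2, hden]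
      calc (3 : ℝ) ^ (-(padicValNat 3 x.den : ℤ)) ≤ (3 : ℝ) ^ (-(4 : ℤ)) := by
            apply zpow_le_zpow_right₀ (by norm_num); omega
        _ = (1 / 9) ^ 2 := by norm_num
    exact (pow_le_pow_iff_left₀ (norm_nonneg _) (by norm_num) two_ne_zero).mp hsq
  have hqj : ‖q‖ = ‖((W.j : ℚ_[3]))⁻¹‖ := by rw [norm_inv, ← hj, norm_tateJ_eq hq, inv_inv]
  rw [hDh _ hadm, heightFourOne_some, ← sub_sub, ← hqj]
  exact norm_heightFourOneCoord_sub_padicLog_num_sub_le_deep_j hW hq hj h hx hz9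

end Canonical

end Summit.BirchSwinnertonDyer.Rank1Residual.X11b.RegMult.HeightLogNumerator

end
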